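import Summits.Parity.BatemanHorn.Theorems.SoloInformedBatemanHornLocalisation

/-!
# SoloInformedSystemTiers — one quantity, three tiers, for every Bateman–Horn system

Solo unit `solo-Parity-informed` (ideation tier, informed mode), session 23; `PLAN.md` §31, CLAIMS C100.

`SoloInformedBatemanHornLocalisation` proved, for a Bateman–Horn system `f` of `k ≥ 1` polynomials,
`F = ∏ fᵢ` and a fixed `0 < ε < 1`, the unconditional formula
`ψ_{k,f}(x) = k!·C(f)·x + (-1)ᵏ T_k(x) + o(x)`, `T_k(x) := ∑_{n ≤ x} ∑_{e ∣ F(n), e > x^{1-ε}} μ(e) logᵏ e`,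
whence `BH(f) ⟺ T_k(x) = o(x)`.  This file records what the SAME quantity `T_k` says below the
asymptotic, uniformly over the conjunct (the system-level form of `SoloInformedLargeDivisorTiers`, which
treated `n² + 1`).  With `θ_f(x) := ∑_{n ≤ x, every |fᵢ(n)| prime} ∏ᵢ log |fᵢ(n)|`:

* `theta_sub_main_sub_signedTail_isLittleO` — `k!·θ_f(x) = k!·C(f)·x + (-1)ᵏ T_k(x) + o(x)`;
* **Tier 0** (unconditional, from `Λ_k ≥ 0`): `(-1)ᵏ T_k(x) ≥ -(k!·C(f) + δ)·x` eventually, for every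
  `δ > 0` (`eventually_neg_mul_le_signedTail`); and the transfer of any upper bound `θ_f(x) ≤ (1+o(1)) K x`
  (an upper-bound sieve) to `(-1)ᵏ T_k(x) ≤ (k!·K - k!·C(f) + δ)·x` (`eventually_signedTail_le_of_theta_le`);
* **Tier 1** (existence): `∃ c > 0, (-1)ᵏ T_k(x) ≥ (c - k!·C(f))·x` for infinitely many `x`
  `⟺ ∃ c > 0, θ_f(x) ≥ c·x` i.o. `⟺ ∃ c > 0, #{n ≤ x : every |fᵢ(n)| prime} ≥ c·x/logᵏ x` i.o.
  (`frequently_signedTail_ge_iff_theta_ge`, `frequently_theta_ge_iff_card_ge`), and each of these gives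
  infinitely many `n` at which every `|fᵢ(n)|` is prime (`infinite_setOf_allPrime_of_frequently_signedTail_ge`);
* **Tier 2** (asymptotic) is `batemanHornAsymptotic_iff_rpowCut_tail_isLittleO`: `BH(f) ⟺ T_k(x) = o(x)`,
  and it implies Tier 1 (`frequently_signedTail_ge_of_batemanHornAsymptotic`).

So ANY constant improvement `c > 0`, along some sequence `x → ∞`, of the trivial bound
`(-1)ᵏ T_k(x) ≥ -(k!·C(f) + o(1))·x` yields infinitely many simultaneous prime values of the system.
The twin prime instance is `SoloInformedTwinPrimeTiers`.  No bearing on the truth of the conjunct: the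
content of every tier is the distribution of the Möbius sign over the large divisors `e > x^{1-ε}` of `F(n)`.
(The statements are generic in the `DecidablePred` instance of "every `|fᵢ(n)|` is prime", so that they
specialise to concrete systems `f : Fin k → ℤ[X]` without instance mismatches.)
-/

namespace Summit.Parity.BatemanHorn.Theorems

open Finset Filter ArithmeticFunction Asymptotics Polynomial
open scoped Topology Nat ArithmeticFunction.Moebius
open Literature.NumberTheory.Sieve (IsBatemanHornSystem batemanHornConst BatemanHornAsymptotic
  generalizedVonMangoldt generalizedVonMangoldt_nonneg)

variable {ι : Type*} [Fintype ι] {f : ι → ℤ[X]} {ε : ℝ}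

/-- From `u = o(x)` along `ℕ`: eventually `|u(x)| ≤ c·x`, for every `c > 0`. -/
theorem eventually_abs_le_mul_of_isLittleO_natCast {u : ℕ → ℝ}
    (hu : u =o[atTop] fun x : ℕ => (x : ℝ)) {c : ℝ} (hc : 0 < c) :
    ∀ᶠ x : ℕ in atTop, |u x| ≤ c * x := by
  filter_upwards [hu.bound hc] with x hx
  simpa only [Real.norm_eq_abs, Nat.abs_cast] using hx

/-! ### The formula at the `θ`-level -/

/-- **`k!·θ_f(x) - k!·C(f)·x - (-1)ᵏ T_k(x) = o(x)`** for every Bateman–Horn system of `k ≥ 1`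
polynomials and every fixed `0 < ε < 1` (`T_k` cut at `x^{1-ε}`): the formula for `ψ_k`
(`psiK_sub_main_sub_tail_isLittleO`) combined with `ψ_k - k!·θ_f = o(x)` (`isLittleO_psiK_sub_theta`). -/
theorem theta_sub_main_sub_signedTail_isLittleO (hf : IsBatemanHornSystem f)
    (hk : 0 < Fintype.card ι) (hε : 0 < ε) (hε1 : ε < 1)
    [inst : DecidablePred fun n : ℕ => ∀ i, Nat.Prime ((f i).eval (n : ℤ)).natAbs] :
    (fun x : ℕ =>
      ((Fintype.card ι)! : ℝ) *
          ∑ n ∈ (Icc 1 x).filter (fun n : ℕ => ∀ i, Nat.Prime ((f i).eval (n : ℤ)).natAbs),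
            ∏ i, Real.log ((((f i).eval (n : ℤ)).natAbs : ℕ) : ℝ)
        - ((Fintype.card ι)! : ℝ) * batemanHornConst f * (x : ℝ)
        - (-1 : ℝ) ^ Fintype.card ι * ∑ n ∈ Icc 1 x,
            ∑ e ∈ (((∏ i, f i).eval (n : ℤ)).natAbs).divisors with ⌊(x : ℝ) ^ (1 - ε)⌋₊ < e,
              (μ e : ℝ) * Real.log e ^ Fintype.card ι) =o[atTop] fun x : ℕ => (x : ℝ) := by
  -- the tree lemma `isLittleO_psiK_sub_theta` carries the default instance; align `inst` with it
  have hI : inst = fun n => Fintype.decidableForallFintype := Subsingleton.elim _ _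
  subst hI
  have h1 := psiK_sub_main_sub_tail_isLittleO hf hk (tendsto_rpowCut_atTop hε1)
    (rpowCut_mul_log_pow_isLittleO hε hε1 _)
  have h2 := isLittleO_psiK_sub_theta hf hk
  refine (h1.sub h2).congr_left fun x => ?_
  ring

/-! ### Tier 0: the trivial bound, unconditionally -/

/-- **Tier 0 (unconditional).**  For every `δ > 0`, eventually
`(-1)ᵏ ∑_{n ≤ x} ∑_{e ∣ F(n), e > x^{1-ε}} μ(e) logᵏ e ≥ -(k!·C(f) + δ)·x` — from `Λ_k ≥ 0`. -/
theorem eventually_neg_mul_le_signedTail (hf : IsBatemanHornSystem f) (hk : 0 < Fintype.card ι)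
    (hε : 0 < ε) (hε1 : ε < 1) {δ : ℝ} (hδ : 0 < δ) :
    ∀ᶠ x : ℕ in atTop,
      -(((Fintype.card ι)! : ℝ) * batemanHornConst f + δ) * (x : ℝ) ≤
        (-1 : ℝ) ^ Fintype.card ι * ∑ n ∈ Icc 1 x,
          ∑ e ∈ (((∏ i, f i).eval (n : ℤ)).natAbs).divisors with ⌊(x : ℝ) ^ (1 - ε)⌋₊ < e,
            (μ e : ℝ) * Real.log e ^ Fintype.card ι := by
  have h1 := psiK_sub_main_sub_tail_isLittleO hf hk (tendsto_rpowCut_atTop hε1)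
    (rpowCut_mul_log_pow_isLittleO hε hε1 _)
  filter_upwards [eventually_abs_le_mul_of_isLittleO_natCast h1 hδ] with x hx
  try dsimp only at hx
  have hψ : 0 ≤ ∑ n ∈ Icc 1 x,
      generalizedVonMangoldt (Fintype.card ι) ((∏ i, f i).eval (n : ℤ)).natAbs :=
    sum_nonneg fun n _ => generalizedVonMangoldt_nonneg _ _
  have h := (abs_le.mp hx).2
  linarith

/-- **Upper transfer.**  An eventual bound `θ_f(x) ≤ (1 + c)·K·x` for every `c > 0` (e.g. from an
upper-bound sieve) gives `(-1)ᵏ T_k(x) ≤ (k!·K - k!·C(f) + δ)·x` eventually, for every `δ > 0`. -/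
theorem eventually_signedTail_le_of_theta_le (hf : IsBatemanHornSystem f) (hk : 0 < Fintype.card ι)
    (hε : 0 < ε) (hε1 : ε < 1)
    [DecidablePred fun n : ℕ => ∀ i, Nat.Prime ((f i).eval (n : ℤ)).natAbs]
    {K : ℝ} (hK : 0 ≤ K)
    (hθ : ∀ c : ℝ, 0 < c → ∀ᶠ x : ℕ in atTop,
      ∑ n ∈ (Icc 1 x).filter (fun n : ℕ => ∀ i, Nat.Prime ((f i).eval (n : ℤ)).natAbs),
          ∏ i, Real.log ((((f i).eval (n : ℤ)).natAbs : ℕ) : ℝ) ≤ (1 + c) * (K * x))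
    {δ : ℝ} (hδ : 0 < δ) :
    ∀ᶠ x : ℕ in atTop,
      (-1 : ℝ) ^ Fintype.card ι * ∑ n ∈ Icc 1 x,
          ∑ e ∈ (((∏ i, f i).eval (n : ℤ)).natAbs).divisors with ⌊(x : ℝ) ^ (1 - ε)⌋₊ < e,
            (μ e : ℝ) * Real.log e ^ Fintype.card ι ≤
        (((Fintype.card ι)! : ℝ) * K - ((Fintype.card ι)! : ℝ) * batemanHornConst f + δ) * (x : ℝ) := by
  have hE := theta_sub_main_sub_signedTail_isLittleO hf hk hε hε1
  have hk0 : (0 : ℝ) < (Fintype.card ι)! := by positivity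
  set c : ℝ := δ / (2 * ((Fintype.card ι)! * K + 1)) with hc
  have hc0 : 0 < c := by positivity
  have hc2 : c * (2 * ((Fintype.card ι)! * K + 1)) = δ := by
    rw [hc]
    field_simp
  have hcK : ((Fintype.card ι)! : ℝ) * K * c ≤ δ / 2 := by linarith
  filter_upwards [hθ c hc0, eventually_abs_le_mul_of_isLittleO_natCast hE (half_pos hδ)]
    with x hθx hEx
  try dsimp only at hEx
  have h := (abs_le.mp hEx).1
  have hθ' := mul_le_mul_of_nonneg_left hθx hk0.le
  have hx0 : (0 : ℝ) ≤ x := Nat.cast_nonneg x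
  have hcx := mul_le_mul_of_nonneg_right hcK hx0
  linarith

/-! ### Tier 1: a constant saving, infinitely often -/

/-- **Tier 1, tail form ⟺ `θ` form.**  `∃ c > 0, (-1)ᵏ T_k(x) ≥ (c - k!·C(f))·x` for infinitely many `x`
`⟺ ∃ c > 0, θ_f(x) ≥ c·x` for infinitely many `x`. -/
theorem frequently_signedTail_ge_iff_theta_ge (hf : IsBatemanHornSystem f) (hk : 0 < Fintype.card ι)
    (hε : 0 < ε) (hε1 : ε < 1)
    [DecidablePred fun n : ℕ => ∀ i, Nat.Prime ((f i).eval (n : ℤ)).natAbs] :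
    (∃ c : ℝ, 0 < c ∧ ∃ᶠ x : ℕ in atTop,
        (c - ((Fintype.card ι)! : ℝ) * batemanHornConst f) * (x : ℝ) ≤
          (-1 : ℝ) ^ Fintype.card ι * ∑ n ∈ Icc 1 x,
            ∑ e ∈ (((∏ i, f i).eval (n : ℤ)).natAbs).divisors with ⌊(x : ℝ) ^ (1 - ε)⌋₊ < e,
              (μ e : ℝ) * Real.log e ^ Fintype.card ι) ↔
      (∃ c : ℝ, 0 < c ∧ ∃ᶠ x : ℕ in atTop,
        c * (x : ℝ) ≤
          ∑ n ∈ (Icc 1 x).filter (fun n : ℕ => ∀ i, Nat.Prime ((f i).eval (n : ℤ)).natAbs),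
            ∏ i, Real.log ((((f i).eval (n : ℤ)).natAbs : ℕ) : ℝ)) := by
  have hE := theta_sub_main_sub_signedTail_isLittleO hf hk hε hε1
  have hk0 : (0 : ℝ) < (Fintype.card ι)! := by positivity
  constructor
  · rintro ⟨c, hc, hfr⟩
    refine ⟨c / (2 * (Fintype.card ι)!), by positivity, ?_⟩
    refine (hfr.and_eventually (eventually_abs_le_mul_of_isLittleO_natCast hE (half_pos hc))).mono
      fun x hx => ?_
    obtain ⟨hx, hb⟩ := hx
    try dsimp only at hb
    have h := (abs_le.mp hb).1
    rw [div_mul_eq_mul_div, div_le_iff₀ (by positivity)]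
    linarith
  · rintro ⟨c, hc, hfr⟩
    refine ⟨(Fintype.card ι)! * c / 2, by positivity, ?_⟩
    refine (hfr.and_eventually (eventually_abs_le_mul_of_isLittleO_natCast hE
      (half_pos (mul_pos hk0 hc)))).mono fun x hx => ?_
    obtain ⟨hx, hb⟩ := hx
    try dsimp only at hb
    have h := (abs_le.mp hb).2
    have hθ' := mul_le_mul_of_nonneg_left hx hk0.le
    linarith

/-- **Tier 1, `θ` form ⟺ counting form** (partial summation with the weights
`∏ᵢ log |fᵢ(n)| ~ (∏ᵢ deg fᵢ)·logᵏ n`):  `∃ c > 0, θ_f(x) ≥ c·x` for infinitely many `x`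
`⟺ ∃ c > 0, #{1 ≤ n ≤ x : every |fᵢ(n)| prime} ≥ c·x/logᵏ x` for infinitely many `x`. -/
theorem frequently_theta_ge_iff_card_ge (hf : IsBatemanHornSystem f) (hk : 0 < Fintype.card ι)
    [DecidablePred fun n : ℕ => ∀ i, Nat.Prime ((f i).eval (n : ℤ)).natAbs] :
    (∃ c : ℝ, 0 < c ∧ ∃ᶠ x : ℕ in atTop,
        c * (x : ℝ) ≤
          ∑ n ∈ (Icc 1 x).filter (fun n : ℕ => ∀ i, Nat.Prime ((f i).eval (n : ℤ)).natAbs),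
            ∏ i, Real.log ((((f i).eval (n : ℤ)).natAbs : ℕ) : ℝ)) ↔
      (∃ c : ℝ, 0 < c ∧ ∃ᶠ x : ℕ in atTop,
        c * (x : ℝ) / Real.log x ^ Fintype.card ι ≤
          (#((Icc 1 x).filter fun n : ℕ => ∀ i, Nat.Prime ((f i).eval (n : ℤ)).natAbs) : ℝ)) := by
  set D : ℝ := ∏ i, ((f i).natDegree : ℝ) with hD
  have hD0 : 0 < D := prod_pos fun i _ => Nat.cast_pos.mpr (hf.natDegree_pos i)
  set w : ℕ → ℝ := fun n => ∏ i, Real.log ((((f i).eval (n : ℤ)).natAbs : ℕ) : ℝ) with hw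
  have hw0 : ∀ n, 0 ≤ w n := fun n => prod_nonneg fun i _ => Real.log_natCast_nonneg _
  have hwe : w ~[atTop] fun n : ℕ => D * Real.log n ^ Fintype.card ι :=
    isEquivalent_prod_log_natAbs_eval hf.natDegree_pos
  have hwb := (isEquivalent_iff_upper_lower (eventually_level_pos (k := Fintype.card ι) hD0)).mp hwe
  constructor
  · rintro ⟨c, hc, hfr⟩
    have hU := eventually_weight_le_level hk.ne' hD0 one_pos hw0 (hwb.1 1 one_pos)
    refine ⟨c / (2 * D), by positivity, ?_⟩
    refine (hfr.and_eventually (hU.and (eventually_ge_atTop 2))).mono fun x hx => ?_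
    obtain ⟨hx, hUx, hx2⟩ := hx
    have hX : (2 : ℝ) ≤ x := by exact_mod_cast hx2
    have hℓ : 0 < Real.log (x : ℝ) := Real.log_pos (by linarith)
    have hθP := weightedCount_le_card_mul_of_le
      (p := fun n : ℕ => ∀ i, Nat.Prime ((f i).eval (n : ℤ)).natAbs) x hUx
    rw [div_le_iff₀ (pow_pos hℓ _), div_mul_eq_mul_div, div_le_iff₀ (by positivity)]
    linarith
  · rintro ⟨c, hc, hfr⟩
    have hLo := eventually_level_le_weight_beyond_cut (k := Fintype.card ι) hD0
      (a := 1 / 2) (by norm_num) (by norm_num) (hwb.2 (1 / 2 / 2) (by norm_num))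
    have hcut := eventually_cut_mul_level_le (k := Fintype.card ι) hD0
      (ε := 1 / 2 / (2 * ((Fintype.card ι : ℝ) + 1))) (by positivity) (a := c * D / 4) (by positivity)
    refine ⟨c * D / 4, by positivity, ?_⟩
    refine (hfr.and_eventually ((hLo.and hcut).and (eventually_ge_atTop 2))).mono fun x hx => ?_
    obtain ⟨hx, ⟨hL, hy⟩, hx2⟩ := hx
    have hX : (2 : ℝ) ≤ x := by exact_mod_cast hx2
    have hℓ : 0 < Real.log (x : ℝ) := Real.log_pos (by linarith)
    have hLB := card_sub_mul_le_weightedCount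
      (p := fun n : ℕ => ∀ i, Nat.Prime ((f i).eval (n : ℤ)).natAbs) hw0 x _
      (L := (1 - 1 / 2) * (D * Real.log (x : ℝ) ^ Fintype.card ι)) (by positivity)
      fun n hn => hL n hn
    rw [div_le_iff₀ (pow_pos hℓ _)] at hx
    have hx' := mul_le_mul_of_nonneg_left hx hD0.le
    have hcDx : 0 ≤ c * D * x := by positivity
    linarith

/-- A weighted count `θ_f(x) ≥ c·x` along a sequence `x → ∞` forces infinitely many `n` at which every
`|fᵢ(n)|` is prime (a finite set has bounded `θ_f`). -/
theorem infinite_setOf_allPrime_of_frequently_theta_ge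
    [DecidablePred fun n : ℕ => ∀ i, Nat.Prime ((f i).eval (n : ℤ)).natAbs]
    (h : ∃ c : ℝ, 0 < c ∧ ∃ᶠ x : ℕ in atTop,
      c * (x : ℝ) ≤
        ∑ n ∈ (Icc 1 x).filter (fun n : ℕ => ∀ i, Nat.Prime ((f i).eval (n : ℤ)).natAbs),
          ∏ i, Real.log ((((f i).eval (n : ℤ)).natAbs : ℕ) : ℝ)) :
    {n : ℕ | ∀ i, Nat.Prime ((f i).eval (n : ℤ)).natAbs}.Infinite := by
  obtain ⟨c, hc, hfr⟩ := h
  intro hfin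
  set B : ℝ := ∑ n ∈ hfin.toFinset, ∏ i, Real.log ((((f i).eval (n : ℤ)).natAbs : ℕ) : ℝ) with hB
  have hθ : ∀ x : ℕ,
      ∑ n ∈ (Icc 1 x).filter (fun n : ℕ => ∀ i, Nat.Prime ((f i).eval (n : ℤ)).natAbs),
          ∏ i, Real.log ((((f i).eval (n : ℤ)).natAbs : ℕ) : ℝ) ≤ B := by
    intro x
    refine sum_le_sum_of_subset_of_nonneg (fun n hn => ?_) fun n _ _ =>
      prod_nonneg fun i _ => Real.log_natCast_nonneg _
    rw [Set.Finite.mem_toFinset]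
    exact (mem_filter.mp hn).2
  obtain ⟨x, hx, hBx⟩ := (hfr.and_eventually
    ((tendsto_natCast_atTop_atTop.const_mul_atTop hc).eventually_gt_atTop B)).exists
  exact lt_irrefl B ((hBx.trans_le hx).trans_le (hθ x))

/-- **Tier 1 on the large-divisor tail ⟹ infinitely many simultaneous prime values.**  If for some
`c > 0` and infinitely many `x`, `(-1)ᵏ ∑_{n ≤ x} ∑_{e ∣ F(n), e > x^{1-ε}} μ(e) logᵏ e ≥ (c - k!·C(f))·x`
— any constant improvement of the trivial bound of `eventually_neg_mul_le_signedTail` — then every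
`|fᵢ(n)|` is prime for infinitely many `n`. -/
theorem infinite_setOf_allPrime_of_frequently_signedTail_ge (hf : IsBatemanHornSystem f)
    (hk : 0 < Fintype.card ι) (hε : 0 < ε) (hε1 : ε < 1)
    (h : ∃ c : ℝ, 0 < c ∧ ∃ᶠ x : ℕ in atTop,
      (c - ((Fintype.card ι)! : ℝ) * batemanHornConst f) * (x : ℝ) ≤
        (-1 : ℝ) ^ Fintype.card ι * ∑ n ∈ Icc 1 x,
          ∑ e ∈ (((∏ i, f i).eval (n : ℤ)).natAbs).divisors with ⌊(x : ℝ) ^ (1 - ε)⌋₊ < e,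
            (μ e : ℝ) * Real.log e ^ Fintype.card ι) :
    {n : ℕ | ∀ i, Nat.Prime ((f i).eval (n : ℤ)).natAbs}.Infinite :=
  infinite_setOf_allPrime_of_frequently_theta_ge
    ((frequently_signedTail_ge_iff_theta_ge hf hk hε hε1).mp h)

/-! ### Tier 2 ⟹ Tier 1 -/

/-- The tiers are nested: `BatemanHornAsymptotic f` (Tier 2, `T_k = o(x)`) gives Tier 1 with
`c = k!·C(f)/2`. -/
theorem frequently_signedTail_ge_of_batemanHornAsymptotic [Nonempty ι] (hf : IsBatemanHornSystem f)
    (hε : 0 < ε) (hε1 : ε < 1) (h : BatemanHornAsymptotic f) :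
    ∃ c : ℝ, 0 < c ∧ ∃ᶠ x : ℕ in atTop,
      (c - ((Fintype.card ι)! : ℝ) * batemanHornConst f) * (x : ℝ) ≤
        (-1 : ℝ) ^ Fintype.card ι * ∑ n ∈ Icc 1 x,
          ∑ e ∈ (((∏ i, f i).eval (n : ℤ)).natAbs).divisors with ⌊(x : ℝ) ^ (1 - ε)⌋₊ < e,
            (μ e : ℝ) * Real.log e ^ Fintype.card ι := by
  obtain ⟨-, hCpos⟩ := IsBatemanHornSystem.hasBatemanHornConst_holds hf
  have hA : 0 < ((Fintype.card ι)! : ℝ) * batemanHornConst f := by positivity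
  have hT := (batemanHornAsymptotic_iff_rpowCut_tail_isLittleO hf hε hε1).mp h
  refine ⟨((Fintype.card ι)! : ℝ) * batemanHornConst f / 2, by positivity,
    Eventually.frequently ?_⟩
  filter_upwards [eventually_abs_le_mul_of_isLittleO_natCast hT (half_pos hA)] with x hx
  try dsimp only at hx
  have h1 := (abs_le.mp hx).1
  have h2 := (abs_le.mp hx).2
  have hx0 : (0 : ℝ) ≤ x := Nat.cast_nonneg x
  rcases neg_one_pow_eq_or ℝ (Fintype.card ι) with hs | hs <;> rw [hs] <;> linarith

end Summit.Parity.BatemanHorn.Theorems
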